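import Mathlib
import Summits.Ventures.HodgeRepro2.Hypothesis
import Summits.Ventures.HodgeRepro2.InvariantFormsGroup

/-!
# The wedge of two invariant 1-forms is an invariant 2-form

For `α ∈ U(2,1)` acting on the ball by `ballAction`, write `J = jacobian α z` for the Jacobian
matrix `J i j = ∂(α·z)_i/∂z_j` (the `fderiv` of `ballAction α` on the basis vectors). The clause
`IsInvariantUnder α q` of `Hypothesis.lean` says `q(z) = Jᵀ q(α·z)`
(`IsInvariantUnder.eq_sum_jacobian`). Hence the coefficient `wedgeAt q₁ q₂ z = q₁₀q₂₁ − q₁₁q₂₀` of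
`q₁ ∧ q₂` transforms by the determinant:

* **`wedgeAt_eq_det_jacobian_mul`**: `wedgeAt q₁ q₂ z = det J · wedgeAt q₁ q₂ (α·z)`.
* `jacobian_mul`, `jacobian_one`: the chain rule for the Jacobian matrices (from
  `InvariantFormsGroup`); **`IsInU21.det_jacobian_ne_zero`**: `det J ≠ 0` on the ball.
* **`wedgeAt_ne_zero_iff`**: for invariant `q₁, q₂` the zero set of `q₁ ∧ q₂` is `α`-stable;
  `WedgeNonzero.ballAction`: a witness of `WedgeNonzero` moves along the orbit.

This is the pointwise content of «`q₁ ∧ q₂` is a `Γ`-invariant holomorphic 2-form on the ball»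
behind the `WedgeNonzero` clause of `NonVanishingInput`. What stays prose: its descent to the
quotient surface `Γ\𝔹²` (not a Lean object here). Everything is proved; no new axioms.
-/

namespace Summit.Ventures.HodgeRepro2.ShimuraData

open Matrix

/-- The Jacobian matrix of `ballAction α` at `z`: `J i j = ∂(α·z)_i/∂z_j`. -/
noncomputable def jacobian (α : Matrix (Fin 3) (Fin 3) ℂ) (z : Fin 2 → ℂ) :
    Matrix (Fin 2) (Fin 2) ℂ :=
  fun i j => fderiv ℂ (ballAction α) z (Pi.single j 1) i

/-- The entries of the Jacobian. -/
theorem jacobian_apply (α : Matrix (Fin 3) (Fin 3) ℂ) (z : Fin 2 → ℂ) (i j : Fin 2) :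
    jacobian α z i j = fderiv ℂ (ballAction α) z (Pi.single j 1) i := rfl

/-- The invariance clause of `Hypothesis.lean`, read with the Jacobian: `q(z) = Jᵀ q(α·z)`. -/
theorem IsInvariantUnder.eq_sum_jacobian {α : Matrix (Fin 3) (Fin 3) ℂ}
    {q : (Fin 2 → ℂ) → Fin 2 → ℂ} (h : IsInvariantUnder α q) {z : Fin 2 → ℂ} (hz : z ∈ ball₂)
    (j : Fin 2) : q z j = ∑ i, q (ballAction α z) i * jacobian α z i j :=
  (h z hz j).symm

/-- The coefficient of `q₁ ∧ q₂` at `z`: `q₁(z)₀ q₂(z)₁ − q₁(z)₁ q₂(z)₀`. -/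
def wedgeAt (q₁ q₂ : (Fin 2 → ℂ) → Fin 2 → ℂ) (z : Fin 2 → ℂ) : ℂ :=
  q₁ z 0 * q₂ z 1 - q₁ z 1 * q₂ z 0

/-- `WedgeNonzero` is the non-vanishing of `wedgeAt` somewhere on the ball. -/
theorem wedgeNonzero_iff_exists_wedgeAt (q₁ q₂ : (Fin 2 → ℂ) → Fin 2 → ℂ) :
    WedgeNonzero q₁ q₂ ↔ ∃ z ∈ ball₂, wedgeAt q₁ q₂ z ≠ 0 := Iff.rfl

/-- **The wedge of two invariant 1-forms transforms by the Jacobian determinant.** -/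
theorem wedgeAt_eq_det_jacobian_mul {α : Matrix (Fin 3) (Fin 3) ℂ}
    {q₁ q₂ : (Fin 2 → ℂ) → Fin 2 → ℂ} (h₁ : IsInvariantUnder α q₁) (h₂ : IsInvariantUnder α q₂)
    {z : Fin 2 → ℂ} (hz : z ∈ ball₂) :
    wedgeAt q₁ q₂ z = (jacobian α z).det * wedgeAt q₁ q₂ (ballAction α z) := by
  unfold wedgeAt
  rw [h₁.eq_sum_jacobian hz 0, h₁.eq_sum_jacobian hz 1, h₂.eq_sum_jacobian hz 0,
    h₂.eq_sum_jacobian hz 1, Matrix.det_fin_two]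
  simp only [Fin.sum_univ_two]
  ring

/-- The chain rule for the Jacobian matrices, on the ball. -/
theorem jacobian_mul {α β : Matrix (Fin 3) (Fin 3) ℂ} (hα : IsInU21 α) (hβ : IsInU21 β)
    {z : Fin 2 → ℂ} (hz : z ∈ ball₂) :
    jacobian (α * β) z = jacobian α (ballAction β z) * jacobian β z := by
  ext i j
  rw [Matrix.mul_apply, jacobian_apply, hα.fderiv_ballAction_mul hβ hz,
    ContinuousLinearMap.comp_apply, clm_apply_eq_sum]
  refine Finset.sum_congr rfl fun l _ => ?_
  rw [jacobian_apply, jacobian_apply, mul_comm]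

/-- The Jacobian of the identity is the identity. -/
theorem jacobian_one (z : Fin 2 → ℂ) : jacobian 1 z = 1 := by
  ext i j
  rw [jacobian_apply, fderiv_ballAction_one, ContinuousLinearMap.id_apply, Matrix.one_apply,
    Pi.single_apply]

/-- **The Jacobian of `α ∈ U(2,1)` is invertible on the ball.** -/
theorem IsInU21.det_jacobian_ne_zero {α : Matrix (Fin 3) (Fin 3) ℂ} (hα : IsInU21 α)
    {z : Fin 2 → ℂ} (hz : z ∈ ball₂) : (jacobian α z).det ≠ 0 := by
  have h := jacobian_mul hα.inv hα hz
  rw [nonsing_inv_mul _ hα.isUnit_det, jacobian_one] at h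
  exact (Matrix.isUnit_det_of_left_inverse h.symm).ne_zero

/-- For invariant `q₁, q₂` and `α ∈ U(2,1)`, the zero set of `q₁ ∧ q₂` on the ball is `α`-stable. -/
theorem wedgeAt_ne_zero_iff {α : Matrix (Fin 3) (Fin 3) ℂ} (hα : IsInU21 α)
    {q₁ q₂ : (Fin 2 → ℂ) → Fin 2 → ℂ} (h₁ : IsInvariantUnder α q₁) (h₂ : IsInvariantUnder α q₂)
    {z : Fin 2 → ℂ} (hz : z ∈ ball₂) :
    wedgeAt q₁ q₂ z ≠ 0 ↔ wedgeAt q₁ q₂ (ballAction α z) ≠ 0 := by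
  rw [wedgeAt_eq_det_jacobian_mul h₁ h₂ hz, mul_ne_zero_iff]
  exact ⟨fun h => h.2, fun h => ⟨hα.det_jacobian_ne_zero hz, h⟩⟩

/-- A witness of `WedgeNonzero` moves along the orbit of `α ∈ U(2,1)`. -/
theorem WedgeNonzero.ballAction {α : Matrix (Fin 3) (Fin 3) ℂ} (hα : IsInU21 α)
    {q₁ q₂ : (Fin 2 → ℂ) → Fin 2 → ℂ} (h₁ : IsInvariantUnder α q₁) (h₂ : IsInvariantUnder α q₂)
    (hw : WedgeNonzero q₁ q₂) : ∃ z ∈ ball₂, wedgeAt q₁ q₂ (ballAction α z) ≠ 0 := by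
  obtain ⟨z, hz, h⟩ := hw
  exact ⟨z, hz, (wedgeAt_ne_zero_iff hα h₁ h₂ hz).1 h⟩

end Summit.Ventures.HodgeRepro2.ShimuraData
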